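import Summits.ValiantsHypothesis.ValiantsHypothesis.Theorems.SymPencilPerFourTwoRowsPerm

/-!
# Route `SymPencil` — `3 × 3` blocks with vanishing `2 × 2` subpermanents and small row/column
# ranks (primitives for Case C of Task T1 of `Cruxes/SdcSuperquadratic/NEXT-RUNG-23.md`;
# `--supports` stmt-ValiantsHypothesis-5674 `SdcSuperquadratic`)

Vectors are indexed by `Fin 4`; a "block" is given by three distinct columns `p, q, s`.
Two vectors `w, ξ` are PERM-ORTHOGONAL on the block if the three `2 × 2` permanents
`w_l ξ_{l'} + w_{l'} ξ_l` (`{l, l'} ⊂ {p, q, s}`) vanish.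

* `exists_gen_of_perm_orth`: for `ξ ≠ 0` on the block, the vectors supported on the block and
  perm-orthogonal to `ξ` are the multiples of one explicit vector (the annihilator is a line).
* `common_support_of_perm_orth₃`: three non-zero block-supported vectors, pairwise
  perm-orthogonal, are all multiples of the same basis vector `e_l`.
(The dimension bound for blocks built on these is `SymPencilPerFourBlockPermRank`.)

Honest framing: linear algebra towards `sdc(per_4) ≥ 25`; nothing here changes
`sdc(per_4) ≥ 23`; the crux stays open; `VP ≠ VNP` is not moved. [folklore]
-/

noncomputable section

-- single-conjunct layout: Sub = Summit, duplicated namespace component intended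
set_option linter.dupNamespace false

namespace Summit.ValiantsHypothesis.ValiantsHypothesis.Theorems.SymPencilPerFourBlockPerm

open Matrix Finset Module
open Literature.Computability.AlgebraicComplexity.AlperBogartVelasco
open Summit.ValiantsHypothesis.ValiantsHypothesis.Theorems.SymPencilPerFourTwoRowsPerm

variable {K : Type*} [Field K]

/-- The fourth column. [folklore] -/
theorem eq_or_of_three_cols (p q s : Fin 4) (hpq : p ≠ q) (hps : p ≠ s) (hqs : q ≠ s) :
    ∃ j : Fin 4, j ≠ p ∧ j ≠ q ∧ j ≠ s ∧ ∀ l : Fin 4, l = p ∨ l = q ∨ l = s ∨ l = j := by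
  revert p q s; decide

/-- **The perm-annihilator of a non-zero vector on a `3`-column block is a line.**  If
`ξ_p ≠ 0`, every block-supported `w` with `w_q ξ_p + w_p ξ_q = 0` and `w_s ξ_p + w_p ξ_s = 0` is a
multiple of `v = ξ_p e_p - ξ_q e_q - ξ_s e_s`. [folklore] -/
theorem exists_gen_of_perm_orth (p q s j : Fin 4) (hpq : p ≠ q) (hps : p ≠ s) (hqs : q ≠ s)
    (hjp : j ≠ p) (hjq : j ≠ q) (hjs : j ≠ s) (hall : ∀ l : Fin 4, l = p ∨ l = q ∨ l = s ∨ l = j)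
    (ξ : Fin 4 → K) (hξ : ξ p ≠ 0) :
    ∃ v : Fin 4 → K, v p ≠ 0 ∧ v j = 0 ∧ ∀ w : Fin 4 → K, w j = 0 →
      w q * ξ p + w p * ξ q = 0 → w s * ξ p + w p * ξ s = 0 → ∃ t : K, w = t • v := by
  classical
  refine ⟨Pi.single p (ξ p) - Pi.single q (ξ q) - Pi.single s (ξ s), ?_, ?_, fun w hwj h1 h2 => ?_⟩
  · simp [Pi.single_eq_of_ne hpq, Pi.single_eq_of_ne hps, hξ]
  · simp [Pi.single_eq_of_ne hjp, Pi.single_eq_of_ne hjq, Pi.single_eq_of_ne hjs]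
  refine ⟨w p / ξ p, funext fun l => ?_⟩
  simp only [Pi.smul_apply, Pi.sub_apply, smul_eq_mul]
  rcases hall l with hl | hl | hl | hl <;> rw [hl]
  · simp [Pi.single_eq_of_ne hpq, Pi.single_eq_of_ne hps]
    field_simp
  · simp [Pi.single_eq_of_ne hpq.symm, Pi.single_eq_of_ne hqs]
    field_simp
    linear_combination h1
  · simp [Pi.single_eq_of_ne hps.symm, Pi.single_eq_of_ne hqs.symm]
    field_simp
    linear_combination h2
  · simp [Pi.single_eq_of_ne hjp, Pi.single_eq_of_ne hjq, Pi.single_eq_of_ne hjs, hwj]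

/-- **Three pairwise perm-orthogonal non-zero vectors on a `3`-column block have a common
one-point support.** [folklore] -/
theorem common_support_of_perm_orth₃ [CharZero K] (p q s j : Fin 4) (hpq : p ≠ q) (hps : p ≠ s)
    (hqs : q ≠ s) (hjp : j ≠ p) (hjq : j ≠ q) (hjs : j ≠ s)
    (hall : ∀ l : Fin 4, l = p ∨ l = q ∨ l = s ∨ l = j)
    (w ξ η : Fin 4 → K) (hwj : w j = 0) (hξj : ξ j = 0) (hηj : η j = 0)
    (hw : w ≠ 0) (hξ : ξ ≠ 0) (hη : η ≠ 0)
    (o1 : ∀ l l' : Fin 4, l ≠ l' → w l * ξ l' + w l' * ξ l = 0)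
    (o2 : ∀ l l' : Fin 4, l ≠ l' → w l * η l' + w l' * η l = 0)
    (o3 : ∀ l l' : Fin 4, l ≠ l' → ξ l * η l' + ξ l' * η l = 0) :
    ∃ l₀ : Fin 4, l₀ ≠ j ∧ ∀ l, l ≠ l₀ → w l = 0 ∧ ξ l = 0 ∧ η l = 0 := by
  -- a non-zero coordinate of `w` on the block; WLOG (by relabelling `p, q, s`) it is `p`
  have key : ∀ (p q s : Fin 4), p ≠ q → p ≠ s → q ≠ s → j ≠ p → j ≠ q → j ≠ s →
      (∀ l : Fin 4, l = p ∨ l = q ∨ l = s ∨ l = j) → w p ≠ 0 →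
      ∃ l₀ : Fin 4, l₀ ≠ j ∧ ∀ l, l ≠ l₀ → w l = 0 ∧ ξ l = 0 ∧ η l = 0 := by
    intro p q s hpq hps hqs hjp hjq hjs hall hwp
    -- `ξ` and `η` are perm-orthogonal to `w`; from `w_p ≠ 0`: `ξ_q, ξ_s, η_q, η_s` in terms of `ξ_p, η_p`
    have e1 := o1 q p hpq.symm   -- w q ξ p + w p ξ q = 0
    have e2 := o1 s p hps.symm   -- w s ξ p + w p ξ s = 0
    have f1 := o2 q p hpq.symm
    have f2 := o2 s p hps.symm
    have g1 := o3 p q hpq        -- ξ p η q + ξ q η p = 0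
    have g2 := o3 p s hps
    have g3 := o3 q s hqs
    -- `ξ_p ≠ 0` and `η_p ≠ 0` (else `ξ = 0` / `η = 0`)
    have hzero : ∀ ζ : Fin 4 → K, ζ j = 0 → (w q * ζ p + w p * ζ q = 0) →
        (w s * ζ p + w p * ζ s = 0) → ζ p = 0 → ζ = 0 := by
      intro ζ hζj h1 h2 hp
      funext l
      rcases hall l with hl | hl | hl | hl <;> rw [hl]
      · exact hp
      · rw [hp, mul_zero, zero_add] at h1; exact (mul_eq_zero.1 h1).resolve_left hwp
      · rw [hp, mul_zero, zero_add] at h2; exact (mul_eq_zero.1 h2).resolve_left hwp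
      · exact hζj
    have hξp : ξ p ≠ 0 := fun h => hξ (hzero ξ hξj e1 e2 h)
    have hηp : η p ≠ 0 := fun h => hη (hzero η hηj f1 f2 h)
    -- `ξ_q = -w_q ξ_p / w_p`, `η_q = -w_q η_p / w_p`; then `g1` gives `w_q = 0`; likewise `w_s = 0`
    have hwq : w q = 0 := by
      have : (2 : K) * (w q * (ξ p * η p)) = 0 := by
        have := g1
        -- multiply `g1` by `w_p` and substitute
        have h' : w p * (ξ p * η q + ξ q * η p) = 0 := by rw [g1, mul_zero]
        linear_combination -h' + ξ p * f1 + η p * e1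
      rcases mul_eq_zero.1 this with h | h
      · exact absurd h two_ne_zero
      · rcases mul_eq_zero.1 h with h | h
        · exact h
        · exact absurd h (mul_ne_zero hξp hηp)
    have hws : w s = 0 := by
      have : (2 : K) * (w s * (ξ p * η p)) = 0 := by
        have h' : w p * (ξ p * η s + ξ s * η p) = 0 := by rw [g2, mul_zero]
        linear_combination -h' + ξ p * f2 + η p * e2
      rcases mul_eq_zero.1 this with h | h
      · exact absurd h two_ne_zero
      · rcases mul_eq_zero.1 h with h | h
        · exact h
        · exact absurd h (mul_ne_zero hξp hηp)
    refine ⟨p, hjp.symm, fun l hl => ?_⟩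
    rcases hall l with h | h | h | h
    · exact absurd h hl
    · subst h
      refine ⟨hwq, ?_, ?_⟩
      · rw [hwq, zero_mul, zero_add] at e1; exact (mul_eq_zero.1 e1).resolve_left hwp
      · rw [hwq, zero_mul, zero_add] at f1; exact (mul_eq_zero.1 f1).resolve_left hwp
    · subst h
      refine ⟨hws, ?_, ?_⟩
      · rw [hws, zero_mul, zero_add] at e2; exact (mul_eq_zero.1 e2).resolve_left hwp
      · rw [hws, zero_mul, zero_add] at f2; exact (mul_eq_zero.1 f2).resolve_left hwp
    · subst h; exact ⟨hwj, hξj, hηj⟩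
  -- pick a non-zero block coordinate of `w`
  by_cases hp : w p ≠ 0
  · exact key p q s hpq hps hqs hjp hjq hjs hall hp
  by_cases hq : w q ≠ 0
  · exact key q p s hpq.symm hqs hps hjq hjp hjs
      (fun l => by rcases hall l with h | h | h | h <;> simp [h]) hq
  by_cases hs : w s ≠ 0
  · exact key s p q hps.symm hqs.symm hpq hjs hjp hjq
      (fun l => by rcases hall l with h | h | h | h <;> simp [h]) hs
  push Not at hp hq hs
  exact absurd (funext fun l => by
    rcases hall l with h | h | h | h <;> rw [h]
    · exact hp
    · exact hq
    · exact hs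
    · exact hwj) hw

/-- The perm-annihilator of a non-zero block-supported vector is a line (coordinate-free form of
`exists_gen_of_perm_orth`). [folklore] -/
theorem exists_gen_of_perm_orth' (p q s j : Fin 4) (hpq : p ≠ q) (hps : p ≠ s) (hqs : q ≠ s)
    (hjp : j ≠ p) (hjq : j ≠ q) (hjs : j ≠ s) (hall : ∀ l : Fin 4, l = p ∨ l = q ∨ l = s ∨ l = j)
    (ξ : Fin 4 → K) (hξj : ξ j = 0) (hξ : ξ ≠ 0) :
    ∃ v : Fin 4 → K, ∀ w : Fin 4 → K, w j = 0 →
      (∀ l l' : Fin 4, l ≠ l' → w l * ξ l' + w l' * ξ l = 0) → ∃ t : K, w = t • v := by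
  have hne : ξ p ≠ 0 ∨ ξ q ≠ 0 ∨ ξ s ≠ 0 := by
    by_contra h
    push Not at h
    exact hξ (funext fun l => by
      rcases hall l with hl | hl | hl | hl <;> rw [hl]
      · exact h.1
      · exact h.2.1
      · exact h.2.2
      · exact hξj)
  rcases hne with h | h | h
  · obtain ⟨v, -, -, hv⟩ := exists_gen_of_perm_orth p q s j hpq hps hqs hjp hjq hjs hall ξ h
    exact ⟨v, fun w hwj ho => hv w hwj (ho q p hpq.symm) (ho s p hps.symm)⟩
  · obtain ⟨v, -, -, hv⟩ := exists_gen_of_perm_orth q p s j hpq.symm hqs hps hjq hjp hjs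
      (fun l => by rcases hall l with h | h | h | h <;> simp [h]) ξ h
    exact ⟨v, fun w hwj ho => hv w hwj (ho p q hpq) (ho s q hqs.symm)⟩
  · obtain ⟨v, -, -, hv⟩ := exists_gen_of_perm_orth s p q j hps.symm hqs.symm hpq hjs hjp hjq
      (fun l => by rcases hall l with h | h | h | h <;> simp [h]) ξ h
    exact ⟨v, fun w hwj ho => hv w hwj (ho p s hps) (ho q s hqs)⟩

end Summit.ValiantsHypothesis.ValiantsHypothesis.Theorems.SymPencilPerFourBlockPerm

end
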